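import Summits.QuantumFields.YangMills.Theorems.BalabanUVNodesN07Prop8StepTokenOfRecordSym152Closed
import Summits.QuantumFields.YangMills.Theorems.BalabanUVNodesK0V22ZDefs
import HarnessLib

/-!
# N07 [B11] (= [15] = [Balaban1985Variational]) Sect. F — MODULE 120: **K0⁷ V22-Z STUB 1's TEXT `Prop8StepCoPGridGAt F` FROM TWO DISPLAYED PREMISES, BY NAME** — the K0 witness's
# integers (`c c₀ c₁`, the grid side, the collar, `M_h = L^{a′}`, `R`), the constants `B₃ a₀ a₁` and the collar letter ALL DISCHARGED: what is displayed is exactly (P1) the conditional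
# premise `HThm4RecSym152PhiE F 2 Mc (ρ₀·L) κ a₀ (ψc·(κ·ε)²)` in COLLAR-UNIFORM form (N05's (B′) road ∕ n07-w3's junction: ONE `ρmin`, `κ = O(ρ₀)`, any `a₀ > 0`, `ψc ≥ 0`, at every
# admissible collar `ρ₀ ∈ ρmin·ℕ`) and (P2) HSEAM = (R4) (∀ step guards)

Cell `pub-ymgap`, seat `pub-ymgap-dag-n07-e` g31 (FAN-OUT §N07 row s3; LANE OWNER of the K0 road chart side).  `--kind proof --supports stmt-QuantumFields-20541 --as helper` (K0⁷);
count-neutral; FOUR theorems (0 `def`).  [15] = [Balaban1985Variational]; [6] = [Balaban1985RegularSpaces]; [3] = [Balaban1985Averaging]; [I] = [Balaban1987RG1].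

WHY.  V22-Z stub 1 of K0⁷ (stmt-QuantumFields-20541) reads `∀ F, Prop8StepCoPGridGAt F` (`…K0V22ZDefs` :46, the registered text byte for byte: `∃ c c₀ c₁ B₃ a₀ a₁, 2L² ≤ B₃ ∧
0 < a₀ ∧ 0 < a₁ ∧ Prop8RegSepTopStepG F 2 suppDom A‴(c, c₀, c₁) B₃ a₀ a₁`).  MODULE 119 ✓ `prop8RegSepTopStepG_of_hThm4RecSym152PhiE_closed` delivers the token at every
admissible collar datum from `hT` + HSEAM + the collar letter; MODULE 118 §2 makes the collar letter true above a threshold for `κ` affine in the collar.  THIS FILE performs the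
K0 witness's choice of integers («R₁M₁ sufficiently big AND a multiple of the big blocks», [15] (163) p. 304, [6] p. 98; «R … sufficiently large», [15] p. 300) and reaches stub 1's
text BY NAME, so that the lane's remaining debt toward K0⁷ stub 1 is DISPLAYED AS TWO NAMED PREMISES and nothing else:
(P1) `∃ ρmin Aκ, 1 ≤ ρmin ∧ 0 ≤ Aκ ∧ ∀ ρ₀, ρmin ∣ ρ₀ → 1 ≤ ρ₀ → ∃ κ a₀ ψc, 0 < κ ∧ κ ≤ Aκ·ρ₀ ∧ 0 < a₀ ∧ 0 ≤ ψc ∧ HThm4RecSym152PhiE F 2 Mc (ρ₀·L) κ a₀ (fun ε j ↦ ψc·(κ·ε j)²)`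
     — the collar-uniform shape of n07-w3's junction `…N07Thm4RecMember152OfRecordCrownSU.hThm4RecMember152_uniform_holds` (there: `κ := b9OfP F Mc (ρ₀L) B₁ ≤ Aκ·ρ₀`,
     `a₀ := a0OfP … > 0`), for the (c-ii)″ premise instead of `HThm4RecMember152` (row 9′ = N05's (B′) road; CONDITIONAL);
(P2) HSEAM for every step guard (R4; the (ii)-docket) — 100⁵'s text at `N := 2`.

v1.1 (§3 APPEND, §1–§2 byte-identical): (P1′) = (P1) at the print letters `κ := b9OfP`, `a₀ := a0OfP` (the Member152 junction's own export shape), `b9OfP_le_linear`.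

WHAT IS PROVED (sorry-free; axioms standard).
§1 ★ `collar_letter_eventually_linear` — for `C_H, B_H, Aκ ≥ 0`, `δ_H > 0`: `∃ ρth, ∀ ρ₀ ≥ ρth, ∀ κ ∈ [0, Aκ·ρ₀], 32·sideP(Mc, ρ₀L)·C_H·B_H·e^{−δ_H ρ₀L}·κ·L ≤ 1` (k0-s1's
   `K0S5HBRows164CoreCubeSeq.exists_collar_threshold` BY NAME after `(ρ₀+1)² ≤ (8∕δ²)e^{δ(ρ₀+1)∕2}`).
§2 ★★★ `prop8StepCoPGridGAt_of_sym152PhiE_uniform_of_seam (F) (Mc) (hMc : 1 ≤ Mc) (hTU : (P1)) (hseam : (P2)) : K0V22ZDefs.Prop8StepCoPGridGAt F` — integers: `a′ := M_h⁰`,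
   `M_h := L^{a′}`, `R := R₀ + 2`, `ρ₀ := ρmin·M_h·t` with `t := ρth + R + Mc + 1`, `ρ := ρ₀·L`, `c := (11·4 + 4ρ + Mc + 3)·L`, `c₀ := Mc + 11·4 + 6ρ + 1 + F.m + a′ + 3`,
   `c₁ := a′ + 1`; then 119 at `a_max := a₀(P1)` and `hThm4RecSym152PhiE_mono` (a₀ down).
HONEST LABEL (binding).  Count-neutral composition + integer bookkeeping; (P1) is CONDITIONAL (N05's (B′) road; its cross-term bound (B′-5)′ in progress) and (P2) is a displayed
HYPOTHESIS ((ii)-docket: under the tree's inclusive `B15DeterminingSets.bondsOf` reading NOT derivable — the converse direction is 37a `…N07CritMultiScaleLamBond.isCritOnFibre_genSet_of_critLam`);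
nothing of [15]∕[6]∕[3] ANALYSIS asserted beyond the cited modules; NO stub registered or closed HERE (stub 1 closes only when (P1) and (P2) are theorems); K0⁷ ∕ K1⁹ NOT closed; N07 NOT
discharged and NOT claimable; counts unmoved (typed 28∕28 · discharged 8∕28); one finite 𝕋⁴ programme at fixed ε — the route closes the conditional finite-𝕋⁴ rung `BalabanLadder.UV`
ONLY; the YM mass gap (Clay) is NOT proved by any of this; nothing continuum ∕ ℝ⁴ ∕ OS.  No `def`, no `instance`, no `notation`, no `sorry`.

References: [15] Prop. 8 p. 304, (144) p. 300, (147)–(163) pp. 301–304; [6] Thm. 4 p. 88, Prop. 6 (1.130)–(1.138) p. 99, p. 98; [3] (26) p. 22, (78)–(81) p. 30; [I] (0.1) p. 251,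
(0.4), (0.11) p. 253.
-/

set_option autoImplicit false

noncomputable section

open scoped BigOperators Matrix.Norms.L2Operator

namespace Summit.QuantumFields.YangMills.BalabanUVNodes.N07Prop8StepCoPGridGOfPremises

open Literature.MathematicalPhysics.QuantumFieldTheory.Balaban1983to89
open Literature.MathematicalPhysics.QuantumFieldTheory.Balaban1983to89.Node00
open Literature.MathematicalPhysics.QuantumFieldTheory.Balaban1983to89.B15DeterminingSets
open T4Continuum (T4Family)
open GaugeField (gaugeAct)
open Summit.QuantumFields.YangMills.BalabanUVNodes.N07Thm4RecordStructureSym152PhiE (HThm4RecSym152PhiE hThm4RecSym152PhiE_mono)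
open Summit.QuantumFields.YangMills.BalabanUVNodes.N07Prop8StepTokenOfRecordSym152Closed (prop8RegSepTopStepG_of_hThm4RecSym152PhiE_closed)
open Summit.QuantumFields.YangMills.Theorems.K0S5HBRows164CoreCubeSeq (exists_collar_threshold)
open Summit.QuantumFields.YangMills.Theorems.K0V22ZDefs (Prop8StepCoPGridGAt)

variable (F : T4Family)

/-! ## §1  The collar letter for `κ = O(ρ₀)` at collar `ρ = ρ₀·L` -/

/-- ★ **THE COLLAR LETTER IS EVENTUALLY TRUE for `κ ≤ Aκ·ρ₀` at collar `ρ₀·L`**: for `C_H, B_H, Aκ ≥ 0`, `δ_H > 0` there is `ρth` with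
`32·sideP(Mc, ρ₀L)·C_H·B_H·e^{−δ_H·ρ₀L}·κ·L ≤ 1` for every `ρ₀ ≥ ρth` and every `κ ∈ [0, Aκ·ρ₀]`. [cite: Balaban1985Variational, (163) p.304; Balaban1985RegularSpaces, p.98] -/
theorem collar_letter_eventually_linear (Mc : ℕ) {CH BH δH Aκ : ℝ} (hCH : 0 ≤ CH) (hBH : 0 ≤ BH) (hδH : 0 < δH) (hAκ : 0 ≤ Aκ) :
    ∃ ρth : ℕ, ∀ ρ₀ : ℕ, ρth ≤ ρ₀ → ∀ κ : ℝ, 0 ≤ κ → κ ≤ Aκ * (ρ₀ : ℝ) →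
      32 * ((sideP (F.P 0) Mc (ρ₀ * F.L) : ℕ) : ℝ) * CH * BH * Real.exp (-(δH * ((ρ₀ * F.L : ℕ) : ℝ))) * (κ * (F.L : ℝ)) ≤ 1 := by
  have hL1 : (1 : ℝ) ≤ F.L := by exact_mod_cast (F.P 0).L_pos
  have hL0 : (0 : ℝ) ≤ F.L := by linarith
  set A₀ : ℝ := 32 * (((Mc : ℝ) + 44 + 2 * (F.L : ℝ)) * CH * BH * (Aκ * (F.L : ℝ))) with hA₀
  have hA₀0 : 0 ≤ A₀ := by positivity
  set A : ℝ := A₀ * (8 / δH ^ 2) * Real.exp (δH / 2) with hA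
  have hA0 : 0 ≤ A := by positivity
  obtain ⟨R₁, hR₁⟩ := exists_collar_threshold hA0 one_pos (half_pos hδH)
  refine ⟨R₁, fun ρ₀ hρ κ hκ0 hκA => ?_⟩
  have hρ0 : (0 : ℝ) ≤ ρ₀ := Nat.cast_nonneg _
  -- `sideP(Mc, ρ₀L) ≤ (Mc + 44 + 2L)(ρ₀ + 1)`, `κ ≤ Aκ(ρ₀ + 1)`
  have hS : ((sideP (F.P 0) Mc (ρ₀ * F.L) : ℕ) : ℝ) ≤ ((Mc : ℝ) + 44 + 2 * (F.L : ℝ)) * ((ρ₀ : ℝ) + 1) := by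
    have h1 : ((sideP (F.P 0) Mc (ρ₀ * F.L) : ℕ) : ℝ) ≤ ((Mc + 11 * (F.P 0).d + 2 * (ρ₀ * F.L) : ℕ) : ℝ) := by
      exact_mod_cast sideP_le (P := F.P 0) Mc (ρ₀ * F.L)
    have h2 : ((Mc + 11 * (F.P 0).d + 2 * (ρ₀ * F.L) : ℕ) : ℝ) = (Mc : ℝ) + 44 + 2 * ((ρ₀ : ℝ) * (F.L : ℝ)) := by rw [T4Family.P_d]; push_cast; ring
    rw [h2] at h1
    nlinarith [mul_nonneg (Nat.cast_nonneg Mc : (0 : ℝ) ≤ Mc) hρ0, mul_nonneg hρ0 hL0]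
  have hS0 : 0 ≤ ((sideP (F.P 0) Mc (ρ₀ * F.L) : ℕ) : ℝ) := Nat.cast_nonneg _
  have hκ1 : κ ≤ Aκ * ((ρ₀ : ℝ) + 1) := hκA.trans (by nlinarith)
  -- `e^{−δ ρ₀ L} ≤ e^{−δ ρ₀}`
  have hcast : ((ρ₀ * F.L : ℕ) : ℝ) = (ρ₀ : ℝ) * (F.L : ℝ) := by push_cast; ring
  have hEL : Real.exp (-(δH * ((ρ₀ * F.L : ℕ) : ℝ))) ≤ Real.exp (-(δH * (ρ₀ : ℝ))) := by
    rw [hcast, Real.exp_le_exp]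
    have : δH * (ρ₀ : ℝ) * 1 ≤ δH * (ρ₀ : ℝ) * (F.L : ℝ) := mul_le_mul_of_nonneg_left hL1 (by positivity)
    linarith
  have hE0 : 0 ≤ Real.exp (-(δH * ((ρ₀ * F.L : ℕ) : ℝ))) := (Real.exp_pos _).le
  have hE0' : 0 ≤ Real.exp (-(δH * (ρ₀ : ℝ))) := (Real.exp_pos _).le
  -- the weight
  have hsq : ((ρ₀ : ℝ) + 1) ^ 2 ≤ 8 / δH ^ 2 * Real.exp (δH / 2 * ((ρ₀ : ℝ) + 1)) := by
    have h1 := Real.pow_div_factorial_le_exp (δH / 2 * ((ρ₀ : ℝ) + 1)) (by positivity) 2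
    have h2 : (δH / 2 * ((ρ₀ : ℝ) + 1)) ^ 2 / (Nat.factorial 2 : ℕ) = δH ^ 2 / 8 * ((ρ₀ : ℝ) + 1) ^ 2 := by
      rw [Nat.factorial_two]; push_cast; ring
    rw [h2] at h1
    have hδ2 : 0 < δH ^ 2 := by positivity
    calc ((ρ₀ : ℝ) + 1) ^ 2 = 8 / δH ^ 2 * (δH ^ 2 / 8 * ((ρ₀ : ℝ) + 1) ^ 2) := by field_simp
      _ ≤ 8 / δH ^ 2 * Real.exp (δH / 2 * ((ρ₀ : ℝ) + 1)) := mul_le_mul_of_nonneg_left h1 (by positivity)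
  have hexp : Real.exp (δH / 2 * ((ρ₀ : ℝ) + 1)) * Real.exp (-(δH * (ρ₀ : ℝ))) = Real.exp (δH / 2) * Real.exp (-(δH / 2 * (ρ₀ : ℝ))) := by
    rw [← Real.exp_add, ← Real.exp_add]; congr 1; ring
  -- assemble
  have hmain : 32 * ((sideP (F.P 0) Mc (ρ₀ * F.L) : ℕ) : ℝ) * CH * BH * Real.exp (-(δH * ((ρ₀ * F.L : ℕ) : ℝ))) * (κ * (F.L : ℝ)) ≤
      A₀ * ((ρ₀ : ℝ) + 1) ^ 2 * Real.exp (-(δH * (ρ₀ : ℝ))) := by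
    have h1 : ((sideP (F.P 0) Mc (ρ₀ * F.L) : ℕ) : ℝ) * κ ≤ (((Mc : ℝ) + 44 + 2 * (F.L : ℝ)) * ((ρ₀ : ℝ) + 1)) * (Aκ * ((ρ₀ : ℝ) + 1)) :=
      mul_le_mul hS hκ1 hκ0 (by positivity)
    have h1' : 0 ≤ ((sideP (F.P 0) Mc (ρ₀ * F.L) : ℕ) : ℝ) * κ := mul_nonneg hS0 hκ0
    have e : 32 * ((sideP (F.P 0) Mc (ρ₀ * F.L) : ℕ) : ℝ) * CH * BH * Real.exp (-(δH * ((ρ₀ * F.L : ℕ) : ℝ))) * (κ * (F.L : ℝ)) =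
        (((sideP (F.P 0) Mc (ρ₀ * F.L) : ℕ) : ℝ) * κ) * (32 * CH * BH * (F.L : ℝ)) * Real.exp (-(δH * ((ρ₀ * F.L : ℕ) : ℝ))) := by ring
    have e' : A₀ * ((ρ₀ : ℝ) + 1) ^ 2 * Real.exp (-(δH * (ρ₀ : ℝ))) =
        ((((Mc : ℝ) + 44 + 2 * (F.L : ℝ)) * ((ρ₀ : ℝ) + 1)) * (Aκ * ((ρ₀ : ℝ) + 1))) * (32 * CH * BH * (F.L : ℝ)) * Real.exp (-(δH * (ρ₀ : ℝ))) := by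
      rw [hA₀]; ring
    rw [e, e']
    exact mul_le_mul (mul_le_mul_of_nonneg_right h1 (by positivity)) hEL hE0 (by positivity)
  have hstep : A₀ * ((ρ₀ : ℝ) + 1) ^ 2 * Real.exp (-(δH * (ρ₀ : ℝ))) ≤ A * Real.exp (-(δH / 2 * (ρ₀ : ℝ))) := by
    calc A₀ * ((ρ₀ : ℝ) + 1) ^ 2 * Real.exp (-(δH * (ρ₀ : ℝ)))
        ≤ A₀ * (8 / δH ^ 2 * Real.exp (δH / 2 * ((ρ₀ : ℝ) + 1))) * Real.exp (-(δH * (ρ₀ : ℝ))) :=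
          mul_le_mul_of_nonneg_right (mul_le_mul_of_nonneg_left hsq hA₀0) hE0'
      _ = A * Real.exp (-(δH / 2 * (ρ₀ : ℝ))) := by
          rw [hA, mul_assoc (A₀ * (8 / δH ^ 2)) (Real.exp (δH / 2)), ← hexp]; ring
  exact hmain.trans (hstep.trans (hR₁ ρ₀ (by exact_mod_cast hρ)))

/-! ## §2  V22-Z stub 1's text from (P1) and (P2) -/

set_option maxHeartbeats 1600000 in
open scoped Classical in
/-- ★★★ **K0⁷ V22-Z STUB 1's TEXT FROM THE TWO DISPLAYED PREMISES**: for a grid side `Mc ≥ 1`, the collar-uniform conditional premise (P1) (row 9′ = N05's (B′) road) and HSEAM (P2)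
for every step guard give `Prop8StepCoPGridGAt F` — the K0 witness's integers, `B₃ a₀ a₁` and the collar letter are chosen ∕ discharged inside (MODULES 118, 119, §1).
[cite: Balaban1985Variational, Prop. 8 p.304, (144) p.300, (147)–(163) pp.301–304; Balaban1985RegularSpaces, Thm. 4 p.88, Prop. 6 (1.130)–(1.138) p.99, p.98; Balaban1985Averaging, (26) p.22, (78)–(81) p.30; Balaban1987RG1, (0.1) p.251, (0.4), (0.11) p.253] -/
theorem prop8StepCoPGridGAt_of_sym152PhiE_uniform_of_seam (Mc : ℕ) (hMc : 1 ≤ Mc)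
    -- ★ (P1) THE CONDITIONAL PREMISE, COLLAR-UNIFORM ((c-ii)″; N05's (B′) road ∕ n07-w3's junction)
    (hTU : ∃ ρmin : ℕ, ∃ Aκ : ℝ, 1 ≤ ρmin ∧ 0 ≤ Aκ ∧ ∀ ρ₀ : ℕ, ρmin ∣ ρ₀ → 1 ≤ ρ₀ →
      ∃ κ a₀ ψc : ℝ, 0 < κ ∧ κ ≤ Aκ * (ρ₀ : ℝ) ∧ 0 < a₀ ∧ 0 ≤ ψc ∧ HThm4RecSym152PhiE F 2 Mc (ρ₀ * F.L) κ a₀ (fun ε j => ψc * (κ * ε j) ^ 2))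
    -- ★ (P2) HSEAM = (R4) for every step guard — displayed, NOT discharged
    (hseam : ∀ (Adm : StepGuard F), ∀ (ν : Stage7Numerics) (M : ℕ) (g : ℕ → ℝ) (K k : ℕ) (s : SeqOfRecord F ν M g K k), Sect2.SeqSeparated ν.M₁ s → 0 < ν.M₁ →
        Adm ν M g K k s → 1 ≤ k →
        ∀ (δ : ℕ → ℝ),
        ∀ W : MSField (F.P K) (SU 2), Sect2.DataSmall7PTop (avOfRecord F 2 K) s.Ω (suppDomOfRecord F ν K s.Ω) k δ W →
        ∀ U : GaugeField (F.P K) 0 (SU 2),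
        AgreeOn (genSet s.Ω k) (avgFamily (avOfRecord F 2 K) U) W → IsCritOnFibre F 2 K (genSet s.Ω k) W U →
        ∀ (hkk : k ≤ (F.P K).m + (F.P K).K),
        ∀ γ : ℝ → GaugeField (F.P K) 0 (SU 2), γ 0 = U →
          DifferentiableAt ℝ (fun (t : ℝ) (b : PBond (F.P K) 0) => ((γ t b : SU 2) : Matrix (Fin 2) (Fin 2) ℂ)) 0 →
            (∀ᶠ t in nhds (0 : ℝ), ∀ (j : ℕ) (c : PBond (F.P K) j), (domainsOfSeq s.Ω k hkk).LamBond j c →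
              avgFamily (avOfRecord F 2 K) (γ t) j c = W j c) →
              ∀ a : ℝ, HasDerivAt (fun t => wilsonAction4 (γ t)) a 0 → a = 0)
    : Prop8StepCoPGridGAt F := by
  obtain ⟨Mh₀, R₀, CH, δH, BH, hCH, hδH, hBH, hhead⟩ := prop8RegSepTopStepG_of_hThm4RecSym152PhiE_closed F 2
  obtain ⟨ρmin, Aκ, hρmin, hAκ, hU⟩ := hTU
  obtain ⟨ρth, hth⟩ := collar_letter_eventually_linear F Mc hCH hBH.le hδH hAκ
  have hL1 : 1 ≤ F.L := (F.P 0).L_pos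
  have hL2 : 2 ≤ F.L := by have := F.hL11; omega
  -- the K0 witness's integers
  set a' : ℕ := Mh₀ with ha'
  set Mh : ℕ := F.L ^ a' with hMh
  have hMh₀ : Mh₀ ≤ Mh := (Nat.lt_pow_self (by omega : 1 < F.L)).le
  have hMh1 : 1 ≤ Mh := Nat.one_le_pow _ _ (by omega)
  set R : ℕ := R₀ + 2 with hR
  set t : ℕ := ρth + R + Mc + 1 with ht
  set ρ₀ : ℕ := ρmin * Mh * t with hρ₀
  have ht1 : 1 ≤ t := by omega
  have hρ₀1 : 1 ≤ ρ₀ := by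
    rw [hρ₀]; exact Nat.one_le_iff_ne_zero.mpr (by positivity)
  have hρ₀t : t ≤ ρ₀ := by
    rw [hρ₀]; exact Nat.le_mul_of_pos_left t (by positivity)
  have hρ₀d : ρmin ∣ ρ₀ := ⟨Mh * t, by rw [hρ₀]; ring⟩
  set ρ : ℕ := ρ₀ * F.L with hρ
  have hρt : t ≤ ρ := hρ₀t.trans (Nat.le_mul_of_pos_right ρ₀ (by omega))
  have hMcρ : Mc ≤ ρ := by omega
  have hLρ : F.L ≤ ρ := by rw [hρ]; exact Nat.le_mul_of_pos_left F.L (by omega)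
  have hdvd : F.L * Mh ∣ ρ := ⟨ρmin * t, by rw [hρ, hρ₀]; ring⟩
  have hRρ : R * (F.L * Mh) ≤ ρ := by
    have h1 : R ≤ ρmin * t :=
      calc R ≤ t := by omega
        _ = 1 * t := (one_mul t).symm
        _ ≤ ρmin * t := Nat.mul_le_mul_right t hρmin
    calc R * (F.L * Mh) ≤ (ρmin * t) * (F.L * Mh) := Nat.mul_le_mul_right _ h1
      _ = ρ := by rw [hρ, hρ₀]; ring
  have hRM : 2 * F.L ≤ R * (F.L * Mh) + 1 := by
    have h1 : 2 * F.L ≤ R * (F.L * Mh) := by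
      calc 2 * F.L = 2 * (F.L * 1) := by ring
        _ ≤ R * (F.L * Mh) := Nat.mul_le_mul (by omega) (Nat.mul_le_mul_left _ hMh1)
    omega
  set c : ℕ := (11 * 4 + 4 * ρ + Mc + 3) * F.L with hc
  set c₀ : ℕ := Mc + 11 * 4 + 6 * ρ + 1 + F.m + a' + 3 with hc₀
  have hc₀row : Mc + 11 * 4 + 6 * ρ + 1 ≤ 2 * F.L ^ c₀ := by
    have h1 : c₀ ≤ F.L ^ c₀ := (Nat.lt_pow_self (by omega : 1 < F.L)).le
    omega
  have hmc₀ : F.m ≤ c₀ := by omega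
  have hac₀ : a' + 3 ≤ c₀ := by omega
  set c₁ : ℕ := a' + 1 with hc₁
  -- the grid guard of the registered text
  set Adm : StepGuard F := fun ν M g K k _s => c ≤ ν.M₁ ∧ k + c₀ ≤ F.m + K ∧ F.L ^ c₁ ∣ M ∧
      ∀ i, 1 ≤ i → i ≤ k → dCubeSide (F.P K).L M (RkOfRecord (F.P K).L ν.r (g i)) i ∣ (F.P K).sitesPerDir 0 with hAdm
  have hAdm₁ : ∀ (ν : Stage7Numerics) (M : ℕ) (g : ℕ → ℝ) (K k : ℕ) (s : SeqOfRecord F ν M g K k), Adm ν M g K k s → c ≤ ν.M₁ ∧ k + c₀ ≤ F.m + K :=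
    fun ν M g K k s h => ⟨h.1, h.2.1⟩
  have hAdm₂ : ∀ (ν : Stage7Numerics) (M : ℕ) (g : ℕ → ℝ) (K k : ℕ) (s : SeqOfRecord F ν M g K k), Adm ν M g K k s → ∀ j : ℕ, 1 ≤ j → j ≤ k →
      F.L * Mh ∣ M * RkOfRecord (F.P K).L ν.r (g j) ∧ dCubeSide (F.P K).L M (RkOfRecord (F.P K).L ν.r (g j)) j ∣ (F.P K).sitesPerDir 0 := by
    intro ν M g K k s h j hj1 hjk
    refine ⟨?_, h.2.2.2 j hj1 hjk⟩
    have h1 : F.L * Mh = F.L ^ c₁ := by rw [hMh, hc₁, pow_succ]; ring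
    rw [h1]
    exact Dvd.dvd.mul_right h.2.2.1 _
  -- (P1) at the chosen collar; the collar letter
  obtain ⟨κ, amax, ψc, hκ, hκA, hamax, hψc, hT0⟩ := hU ρ₀ hρ₀d hρ₀1
  have hcollar : 32 * ((sideP (F.P 0) Mc ρ : ℕ) : ℝ) * CH * BH * Real.exp (-(δH * (ρ : ℝ))) * (κ * (F.L : ℝ)) ≤ 1 :=
    hth ρ₀ (by omega) κ hκ.le hκA
  -- the closed head
  obtain ⟨a₀, ha₀, ha₀max, hrest⟩ :=
    hhead (ρ := ρ) (Mc := Mc) (Mh := Mh) (R := R) (a' := a') hMc hMcρ hMh hMh₀ (by omega) hdvd hRρ hLρ hRM (c := c) (c₀ := c₀) le_rfl hc₀row hmc₀ hac₀ Adm hAdm₁ hAdm₂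
      hκ hψc hamax hcollar
  have hT : HThm4RecSym152PhiE F 2 Mc ρ κ a₀ (fun ε j => ψc * (κ * ε j) ^ 2) :=
    hThm4RecSym152PhiE_mono hκ le_rfl ha₀max (fun _ _ => le_rfl) hT0
  obtain ⟨B₃, a₁, hB₃L, ha₁, htok⟩ := hrest hT (hseam Adm)
  unfold Prop8StepCoPGridGAt
  exact ⟨c, c₀, c₁, B₃, a₀, a₁, hB₃L, ha₀, ha₁, htok⟩


/-! ## §3  (v1.1) (P1) AT THE PRINT LETTERS `b9OfP ∕ a0OfP` — the Member152 junction's own export shape -/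

/-- `b9OfP` grows at most linearly in the collar index: `b9OfP F Mc (ρ₀·L) B₁ ≤ (112·L⁵·B₁·(L·Mc + 44 + 2L) + 1)·ρ₀` (`ρ₀ ≥ 1`, `B₁ ≥ 0`).
[cite: Balaban1985Variational, (152) p.301 (bookkeeping)] -/
theorem b9OfP_le_linear (Mc : ℕ) {B₁ : ℝ} (hB₁ : 0 ≤ B₁) {ρ₀ : ℕ} (hρ₀ : 1 ≤ ρ₀) :
    b9OfP F Mc (ρ₀ * F.L) B₁ ≤ (112 * (F.L : ℝ) ^ 5 * B₁ * ((F.L : ℝ) * Mc + 44 + 2 * (F.L : ℝ)) + 1) * (ρ₀ : ℝ) := by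
  have hρ : (1 : ℝ) ≤ ρ₀ := by exact_mod_cast hρ₀
  have hL0 : (0 : ℝ) ≤ F.L := Nat.cast_nonneg _
  unfold b9OfP
  push_cast
  have h1 : 0 ≤ 112 * (F.L : ℝ) ^ 5 * B₁ := by positivity
  have h3 : 0 ≤ ((F.L : ℝ) * Mc + 44) * ((ρ₀ : ℝ) - 1) := mul_nonneg (by positivity) (by linarith)
  have h2 : (F.L : ℝ) * Mc + 44 + 2 * ((ρ₀ : ℝ) * (F.L : ℝ)) ≤ ((F.L : ℝ) * Mc + 44 + 2 * (F.L : ℝ)) * (ρ₀ : ℝ) := by linarith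
  calc 112 * (F.L : ℝ) ^ 5 * B₁ * ((F.L : ℝ) * Mc + 44 + 2 * ((ρ₀ : ℝ) * (F.L : ℝ))) + 1
      ≤ 112 * (F.L : ℝ) ^ 5 * B₁ * (((F.L : ℝ) * Mc + 44 + 2 * (F.L : ℝ)) * (ρ₀ : ℝ)) + 1 * (ρ₀ : ℝ) :=
        add_le_add (mul_le_mul_of_nonneg_left h2 h1) (by linarith)
    _ = (112 * (F.L : ℝ) ^ 5 * B₁ * ((F.L : ℝ) * Mc + 44 + 2 * (F.L : ℝ)) + 1) * (ρ₀ : ℝ) := by ring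

set_option maxHeartbeats 800000 in
open scoped Classical in
/-- ★★ **V22-Z STUB 1's TEXT FROM (P1) AT THE PRINT LETTERS**: the §2 theorem with (P1) in the export shape of n07-w3's Member152 junction
`hThm4RecMember152_uniform_holds` — ONE `(ρmin, B₁, c₁′, ψc)`, `κ := b9OfP F Mc (ρ₀·L) B₁`, `a₀ := a0OfP F 2 Mc (ρ₀·L) B₁ c₁′`, `Ψ ε j := ψc·(κ·ε_j)²` at every collar
`ρ₀ ∈ ρmin·ℕ` — and HSEAM (P2).  `κ ≤ Aκ·ρ₀` by `b9OfP_le_linear`, `0 < a₀` by `a0OfP_pos`.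
[cite: Balaban1985Variational, Prop. 8 p.304, (152) p.301, (163) p.304; Balaban1985RegularSpaces, Prop. 6 (1.130)–(1.138) p.99; Balaban1987RG1, (0.4), (0.11) p.253] -/
theorem prop8StepCoPGridGAt_of_sym152PhiE_printLetters_of_seam (Mc : ℕ) (hMc : 1 ≤ Mc)
    -- ★ (P1′) THE CONDITIONAL PREMISE AT THE PRINT LETTERS ((c-ii)″; N05's (B′) road ∕ n07-w3's junction)
    (hTP : ∃ ρmin : ℕ, ∃ B₁ c₁ ψc : ℝ, 1 ≤ ρmin ∧ 0 ≤ B₁ ∧ 0 < c₁ ∧ 0 ≤ ψc ∧ ∀ ρ₀ : ℕ, ρmin ∣ ρ₀ → 1 ≤ ρ₀ →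
      HThm4RecSym152PhiE F 2 Mc (ρ₀ * F.L) (b9OfP F Mc (ρ₀ * F.L) B₁) (a0OfP F 2 Mc (ρ₀ * F.L) B₁ c₁)
        (fun ε j => ψc * (b9OfP F Mc (ρ₀ * F.L) B₁ * ε j) ^ 2))
    -- ★ (P2) HSEAM = (R4) for every step guard — displayed, NOT discharged
    (hseam : ∀ (Adm : StepGuard F), ∀ (ν : Stage7Numerics) (M : ℕ) (g : ℕ → ℝ) (K k : ℕ) (s : SeqOfRecord F ν M g K k), Sect2.SeqSeparated ν.M₁ s → 0 < ν.M₁ →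
        Adm ν M g K k s → 1 ≤ k →
        ∀ (δ : ℕ → ℝ),
        ∀ W : MSField (F.P K) (SU 2), Sect2.DataSmall7PTop (avOfRecord F 2 K) s.Ω (suppDomOfRecord F ν K s.Ω) k δ W →
        ∀ U : GaugeField (F.P K) 0 (SU 2),
        AgreeOn (genSet s.Ω k) (avgFamily (avOfRecord F 2 K) U) W → IsCritOnFibre F 2 K (genSet s.Ω k) W U →
        ∀ (hkk : k ≤ (F.P K).m + (F.P K).K),
        ∀ γ : ℝ → GaugeField (F.P K) 0 (SU 2), γ 0 = U →
          DifferentiableAt ℝ (fun (t : ℝ) (b : PBond (F.P K) 0) => ((γ t b : SU 2) : Matrix (Fin 2) (Fin 2) ℂ)) 0 →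
            (∀ᶠ t in nhds (0 : ℝ), ∀ (j : ℕ) (c : PBond (F.P K) j), (domainsOfSeq s.Ω k hkk).LamBond j c →
              avgFamily (avOfRecord F 2 K) (γ t) j c = W j c) →
              ∀ a : ℝ, HasDerivAt (fun t => wilsonAction4 (γ t)) a 0 → a = 0)
    : Prop8StepCoPGridGAt F := by
  obtain ⟨ρmin, B₁, c₁, ψc, hρmin, hB₁, hc₁, hψc, h⟩ := hTP
  refine prop8StepCoPGridGAt_of_sym152PhiE_uniform_of_seam F Mc hMc
    ⟨ρmin, 112 * (F.L : ℝ) ^ 5 * B₁ * ((F.L : ℝ) * Mc + 44 + 2 * (F.L : ℝ)) + 1, hρmin, by positivity, fun ρ₀ hd h1 => ?_⟩ hseam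
  refine ⟨b9OfP F Mc (ρ₀ * F.L) B₁, a0OfP F 2 Mc (ρ₀ * F.L) B₁ c₁, ψc, ?_, b9OfP_le_linear F Mc hB₁ h1, a0OfP_pos Mc (ρ₀ * F.L) hB₁ hc₁, hψc, h ρ₀ hd h1⟩
  unfold b9OfP
  have hL0 : (0 : ℝ) ≤ F.L := Nat.cast_nonneg _
  positivity

end Summit.QuantumFields.YangMills.BalabanUVNodes.N07Prop8StepCoPGridGOfPremises

end
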